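import Mathlib
import HarnessLib
import Summits.HubbardSuperconductivity.HubbardSuperconductivity.Theorems.KLProgrammePerturbedFermiCurveUniformCooper
import Summits.HubbardSuperconductivity.HubbardSuperconductivity.Theorems.KLProgrammePerturbedFermiCurveUniformCaustic
import Summits.HubbardSuperconductivity.HubbardSuperconductivity.Theorems.KLProgrammePerturbedFermiCurveAngularBound
import Summits.HubbardSuperconductivity.HubbardSuperconductivity.Theorems.KLProgrammePerturbedFermiCurveTwoShellTube

/-!
# Route `KLProgramme` — ENGINE child (stmt-HubbardSuperconductivity-20437 `KLRegimeEngineV17F2`): the two-shell AREA bound of the frame band with constants UNIFORM in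
# the frame (steps (T3c)+(T3d); design note HOME/hubbard-kl-k3c2-p2/TWO-SHELL-FRAME-PORT.md §10)

Cell `gate-hubbard-kl`, seat hubbard-kl-k3c2-p2 g15.
* **`exists_angular_bound_uniform`** — `exists_angular_bound_frame` with constants from `(B, κ₁, Kc, r₀, g₀, w, η⋆)` alone (uniform Cooper/away packages):
  `|{θ : |E(p_ν(θ) − w⃗) − ν| ≤ δ}| ≤ C₁δ/r + C₂√δ` for every admissible frame, level, transfer and torus-distance lower bound `r`;
* **`exists_twoShell_area_uniform`** — with the tube reduction `volume_twoShell_le_frame`: constants `ε₀, C₁, C₂ > 0` such that for every admissible frame and level and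
  `0 < ε₁ ≤ ε₂ ≤ ε₀`: `vol{x ∈ [−π,π)² : |E(x) − ν| < ε₁, |E(x − w⃗) − ν| ≤ ε₂} ≤ C₁ε₁ε₂/r + C₂ε₁√ε₂` — DECOMP App. E Lemma E.1/E.3 for the frame band,
  uniformly in the degree of the frame.
Everything is PROVED; no definitions, no named facts; nothing asserts any stub or superconductivity.
References: DECOMP App. E Lemmas E.1/E.3; FST II App. B [cite: FeldmanSalmhoferTrubowitz1998]; BGM 2006 §2.4, §2.7 [cite: BenfattoGiulianiMastropietro2006].
-/

noncomputable section

namespace Summit.HubbardSuperconductivity.HubbardSuperconductivity.Theorems.PerturbedFermiCurve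

set_option linter.dupNamespace false -- summit = problem name (single-conjunct summit), D-0017

open Real Set MeasureTheory
open scoped ENNReal
open Literature.MathematicalPhysics.QuantumLattice Literature.MathematicalPhysics.QuantumLattice.BandSectorCounting
open Literature.MathematicalPhysics.QuantumLattice.FermiRG
open Summit.HubbardSuperconductivity.HubbardSuperconductivity.Theorems.DispersionFlow
open Summit.HubbardSuperconductivity.HubbardSuperconductivity.Theorems.KLRegimeSplit

/-- **Lemmas E.1/E.3, angular form, every transfer, uniformly in the frame.** [cite: FeldmanSalmhoferTrubowitz1998, App. B] -/
theorem exists_angular_bound_uniform {a b : ℝ} (B : BandBounds a b) {κ₀ κ₁ Kc r₀ g₀ w ηs : ℝ} (hκ₁0 : 0 ≤ κ₁) (hκ₁ : κ₁ < B.Dtmin)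
    (hKc : 0 ≤ Kc) (hr₀ : 0 < r₀) (hg₀ : 0 < g₀) (hw : 0 < w) (hηs : 0 < ηs) :
    ∃ δ₀ C₁ C₂ : ℝ, 0 < δ₀ ∧ 0 < C₁ ∧ 0 < C₂ ∧
      ∀ (K : TrigPolyC4v) (μ : ℝ),
        (∀ k : Fin 2 → ℝ, (∀ i, |k i| ≤ π) → |(fun k : Fin 2 → ℝ => -K.eval k) k| ≤ κ₀) →
        (∀ k : Fin 2 → ℝ, (∀ i, |k i| ≤ π) → ‖fderiv ℝ (fun k : Fin 2 → ℝ => -K.eval k) k‖ ≤ κ₁) →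
        GeomConstants (frameLevel μ K) Kc r₀ g₀ w →
      ∀ ν : ℝ, a + ηs ≤ ν - κ₀ → ν + κ₀ ≤ b - ηs → |ν - μ| ≤ r₀ / 2 →
        ∀ (δ : ℝ) (wv : Fin 2 → ℝ) (θ₀ r : ℝ), 0 < δ → δ ≤ δ₀ → 0 < r → (∀ m : Fin 2 → ℤ, ∃ i, r ≤ |wv i + m i * (2 * π)|) →
          volume {θ ∈ Icc θ₀ (θ₀ + 2 * π) |
              |sqDispersion (perturbedFermiRadius (fun k : Fin 2 → ℝ => -K.eval k) ν θ • dir θ - wv) +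
                  -K.eval (perturbedFermiRadius (fun k : Fin 2 → ℝ => -K.eval k) ν θ • dir θ - wv) - ν| ≤ δ} ≤
            ENNReal.ofReal (C₁ * δ / r + C₂ * Real.sqrt δ) := by
  have hπ := Real.pi_pos
  obtain ⟨vC, δ₁, C, hvC, hδ₁, hC, hcooper⟩ := exists_cooper_bound_uniform B (κ₀ := κ₀) (r₀ := r₀) (g₀ := g₀) hκ₁0 hκ₁ hKc hw hηs
  obtain ⟨δ₁', C₁', C₂', hδ₁', hC₁', hC₂', haway⟩ := exists_away_bound_uniform B (κ₀ := κ₀) hκ₁0 hκ₁ hKc hr₀ hg₀ hw hηs hvC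
  refine ⟨min δ₁ δ₁', C + C₁' * π, C₂', lt_min hδ₁ hδ₁', by positivity, hC₂', ?_⟩
  intro K μ hδ hκ hG ν hνlo hνhi hνμ δ wv θ₀ r hδ0 hδle hr htor
  have hνlt : |ν - μ| < r₀ := by linarith only [hνμ, hr₀]
  have hδ1 : δ ≤ δ₁ := hδle.trans (min_le_left _ _)
  have hδ1' : δ ≤ δ₁' := hδle.trans (min_le_right _ _)
  set u := perturbedFermiRadius (fun k : Fin 2 → ℝ => -K.eval k) ν with hudef
  obtain ⟨m₀, hm₀⟩ : ∃ m : Fin 2 → ℤ, ∀ i, |wv i + m i * (2 * π)| ≤ π := by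
    choose m hm using fun i => exists_int_abs_sub_le_pi (wv i)
    refine ⟨fun i => -m i, fun i => ?_⟩
    have := hm i
    rwa [show wv i + ((-m i : ℤ) : ℝ) * (2 * π) = wv i - m i * (2 * π) by push_cast; ring]
  have hrπ : r ≤ π := by obtain ⟨i, hi⟩ := htor m₀; exact hi.trans (hm₀ i)
  by_cases hfar : ∀ m : Fin 2 → ℤ, ∃ i, vC ≤ |wv i + m i * (2 * π)|
  · have h := haway K μ hδ hκ hG ν hνlo hνhi hνμ δ wv θ₀ hδ0 hδ1' hfar
    refine h.trans (ENNReal.ofReal_le_ofReal ?_)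
    have h1 : C₁' * δ ≤ C₁' * π * δ / r := by
      rw [le_div_iff₀ hr]
      have := mul_le_mul_of_nonneg_left hrπ (by positivity : 0 ≤ C₁' * δ)
      linarith only [this]
    have h2 : 0 ≤ C * δ / r := by positivity
    have e : (C + C₁' * π) * δ / r = C * δ / r + C₁' * π * δ / r := by ring
    rw [e]; linarith only [h1, h2]
  · push Not at hfar
    obtain ⟨m, hm⟩ := hfar
    set w' : Fin 2 → ℝ := fun i => wv i + m i * (2 * π) with hw'
    have hrM : r ≤ max |w' 0| |w' 1| := by
      obtain ⟨i, hi⟩ := htor m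
      fin_cases i
      · exact hi.trans (le_max_left _ _)
      · exact hi.trans (le_max_right _ _)
    have hM0 : 0 < max |w' 0| |w' 1| := hr.trans_le hrM
    have hMv : max |w' 0| |w' 1| ≤ vC := max_le (hm 0).le (hm 1).le
    have h := hcooper K μ hδ hκ hG ν hνlo hνhi hνlt δ w' θ₀ hδ0 hδ1 hM0 hMv
    have hset : {θ ∈ Icc θ₀ (θ₀ + 2 * π) | |sqDispersion (u θ • dir θ - w') + -K.eval (u θ • dir θ - w') - ν| ≤ δ} =
        {θ ∈ Icc θ₀ (θ₀ + 2 * π) | |sqDispersion (u θ • dir θ - wv) + -K.eval (u θ • dir θ - wv) - ν| ≤ δ} := by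
      ext θ
      simp only [mem_setOf_eq, hw', transLevel_transfer_add_int_mul_eq]
    rw [hset] at h
    refine h.trans (ENNReal.ofReal_le_ofReal ?_)
    have h1 : C * δ / max |w' 0| |w' 1| ≤ C * δ / r := div_le_div_of_nonneg_left (by positivity) hr hrM
    have h2 : 0 ≤ C₁' * π * δ / r := by positivity
    have h3 : 0 ≤ C₂' * Real.sqrt δ := by positivity
    have e : (C + C₁' * π) * δ / r = C * δ / r + C₁' * π * δ / r := by ring
    rw [e]; linarith only [h1, h2, h3]

/-- **The two-shell AREA bound of the frame band, uniformly in the frame** (DECOMP App. E Lemma E.1/E.3: `C₁ε₁ε₂/r + C₂ε₁√ε₂` for `0 < ε₁ ≤ ε₂ ≤ ε₀` and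
every torus-distance lower bound `0 < r` of the transfer). [cite: FeldmanSalmhoferTrubowitz1998, App. B] -/
theorem exists_twoShell_area_uniform {a b : ℝ} (B : BandBounds a b) {κ₀ κ₁ Kc r₀ g₀ w ηs : ℝ} (hκ₁0 : 0 ≤ κ₁) (hκ₁ : κ₁ < B.Dtmin)
    (hKc : 0 ≤ Kc) (hr₀ : 0 < r₀) (hg₀ : 0 < g₀) (hw : 0 < w) (hηs : 0 < ηs) :
    ∃ ε₀ C₁ C₂ : ℝ, 0 < ε₀ ∧ 0 < C₁ ∧ 0 < C₂ ∧
      ∀ (K : TrigPolyC4v) (μ : ℝ),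
        (∀ k : Fin 2 → ℝ, (∀ i, |k i| ≤ π) → |(fun k : Fin 2 → ℝ => -K.eval k) k| ≤ κ₀) →
        (∀ k : Fin 2 → ℝ, (∀ i, |k i| ≤ π) → ‖fderiv ℝ (fun k : Fin 2 → ℝ => -K.eval k) k‖ ≤ κ₁) →
        GeomConstants (frameLevel μ K) Kc r₀ g₀ w →
      ∀ ν : ℝ, a + ηs ≤ ν - κ₀ → ν + κ₀ ≤ b - ηs → |ν - μ| ≤ r₀ / 2 →
        ∀ (ε₁ ε₂ : ℝ) (wv : Fin 2 → ℝ) (r : ℝ), 0 < ε₁ → ε₁ ≤ ε₂ → ε₂ ≤ ε₀ → 0 < r →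
          (∀ m : Fin 2 → ℤ, ∃ i, r ≤ |wv i + m i * (2 * π)|) →
          volume {x : ℝ × ℝ | (x.1 ∈ Ico (-π) π ∧ x.2 ∈ Ico (-π) π) ∧
              |sqDispersion ![x.1, x.2] + -K.eval ![x.1, x.2] - ν| < ε₁ ∧
              |sqDispersion (![x.1, x.2] - wv) + -K.eval (![x.1, x.2] - wv) - ν| ≤ ε₂} ≤
            ENNReal.ofReal (C₁ * ε₁ * ε₂ / r + C₂ * ε₁ * Real.sqrt ε₂) := by
  have hπ := Real.pi_pos
  obtain ⟨δ₀, D₁, D₂, hδ₀, hD₁, hD₂, hang⟩ := exists_angular_bound_uniform B (κ₀ := κ₀) hκ₁0 hκ₁ hKc hr₀ hg₀ hw hηs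
  have hD : 0 < B.Dtmin - κ₁ := sub_pos.2 hκ₁
  set L := 1 / (B.Dtmin - κ₁) with hL
  have hL0 : 0 < L := by rw [hL]; positivity
  set κ' := 1 + (4 + κ₁) * L with hκ'
  have hκ'1 : 1 ≤ κ' := by
    have h0 : 0 ≤ (4 + κ₁) * L := by positivity
    rw [hκ']; linarith only [h0]
  have hκ'0 : 0 < κ' := one_pos.trans_le hκ'1
  refine ⟨min (δ₀ / κ') ηs, 16 * L * D₁ * κ', 16 * L * D₂ * Real.sqrt κ', lt_min (by positivity) hηs, by positivity, by positivity, ?_⟩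
  intro K μ hδ hκ hG ν hνlo hνhi hνμ ε₁ ε₂ wv r hε₁ h12 hε₂ hr htor
  have hε₂0 : 0 < ε₂ := hε₁.trans_le h12
  have hε₂δ : ε₂ ≤ δ₀ / κ' := hε₂.trans (min_le_left _ _)
  have hε₁η : ε₁ ≤ ηs := (h12.trans hε₂).trans (min_le_right _ _)
  have hlo : a ≤ ν - κ₀ - ε₁ := by linarith only [hνlo, hε₁η]
  have hhi : ν + κ₀ + ε₁ ≤ b := by linarith only [hνhi, hε₁η]
  -- the tube reduction
  have htube := volume_twoShell_le_frame B hδ hκ hκ₁ ν ε₁ ε₂ wv hε₁ hlo hhi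
  rw [← hL] at htube
  set δ' := ε₂ + (4 + κ₁) * L * ε₁ with hδ'
  have hδ'le : δ' ≤ κ' * ε₂ := by
    rw [hδ', hκ']
    have : (4 + κ₁) * L * ε₁ ≤ (4 + κ₁) * L * ε₂ := mul_le_mul_of_nonneg_left h12 (by positivity)
    linarith
  have hδ'0 : 0 < δ' := by rw [hδ']; positivity
  have hδ'δ₀ : δ' ≤ δ₀ := by
    refine hδ'le.trans ?_
    have := mul_le_mul_of_nonneg_left hε₂δ hκ'0.le
    rw [mul_div_cancel₀ _ hκ'0.ne'] at this
    exact this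
  -- the angular bound on the period `[-π, π]`
  set u := perturbedFermiRadius (fun k : Fin 2 → ℝ => -K.eval k) ν with hudef
  have hΘ : volume {θ ∈ Ioo (-π) π |
        |sqDispersion (u θ • dir θ - wv) + -K.eval (u θ • dir θ - wv) - ν| ≤ ε₂ + (4 + κ₁) * L * ε₁} ≤
      ENNReal.ofReal (D₁ * δ' / r + D₂ * Real.sqrt δ') := by
    have h := hang K μ hδ hκ hG ν hνlo hνhi hνμ δ' wv (-π) r hδ'0 hδ'δ₀ hr htor
    refine le_trans (measure_mono ?_) h
    intro θ hθ
    refine ⟨⟨hθ.1.1.le, by linarith [hθ.1.2]⟩, ?_⟩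
    rw [← hδ'] at hθ
    exact hθ.2
  refine htube.trans ?_
  calc ENNReal.ofReal (16 * L * ε₁) *
        volume {θ ∈ Ioo (-π) π | |sqDispersion (u θ • dir θ - wv) + -K.eval (u θ • dir θ - wv) - ν| ≤ ε₂ + (4 + κ₁) * L * ε₁}
      ≤ ENNReal.ofReal (16 * L * ε₁) * ENNReal.ofReal (D₁ * δ' / r + D₂ * Real.sqrt δ') := by gcongr
    _ = ENNReal.ofReal (16 * L * ε₁ * (D₁ * δ' / r + D₂ * Real.sqrt δ')) := (ENNReal.ofReal_mul (by positivity)).symm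
    _ ≤ ENNReal.ofReal (16 * L * D₁ * κ' * ε₁ * ε₂ / r + 16 * L * D₂ * Real.sqrt κ' * ε₁ * Real.sqrt ε₂) := ENNReal.ofReal_le_ofReal ?_
  -- `δ' ≤ κ'ε₂`, `√δ' ≤ √κ' √ε₂`
  have h1 : D₁ * δ' / r ≤ D₁ * (κ' * ε₂) / r := by
    refine div_le_div_of_nonneg_right ?_ hr.le
    exact mul_le_mul_of_nonneg_left hδ'le hD₁.le
  have h2 : Real.sqrt δ' ≤ Real.sqrt κ' * Real.sqrt ε₂ := by
    rw [← Real.sqrt_mul hκ'0.le]; exact Real.sqrt_le_sqrt hδ'le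
  have h3 : D₂ * Real.sqrt δ' ≤ D₂ * (Real.sqrt κ' * Real.sqrt ε₂) := mul_le_mul_of_nonneg_left h2 hD₂.le
  have h4 : 16 * L * ε₁ * (D₁ * δ' / r + D₂ * Real.sqrt δ') ≤ 16 * L * ε₁ * (D₁ * (κ' * ε₂) / r + D₂ * (Real.sqrt κ' * Real.sqrt ε₂)) :=
    mul_le_mul_of_nonneg_left (add_le_add h1 h3) (by positivity)
  have e : 16 * L * ε₁ * (D₁ * (κ' * ε₂) / r + D₂ * (Real.sqrt κ' * Real.sqrt ε₂)) =
      16 * L * D₁ * κ' * ε₁ * ε₂ / r + 16 * L * D₂ * Real.sqrt κ' * ε₁ * Real.sqrt ε₂ := by ring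
  linarith only [h4, e]

end Summit.HubbardSuperconductivity.HubbardSuperconductivity.Theorems.PerturbedFermiCurve

end
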